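import Summits.QuantumAdvantage.QuantumAdvantage.Theorems.CharDialPartyDialI8

/-!
# PartyDial (decomp-qadv lens-5 g35), part I9 — §8j: TIGHTNESS IN p — ★ `not_fullSumIndep3At_three : ¬ FullSumIndep3At 3 2 (1/5) m₀` for every m₀ (at p = 3 the Boolean [#ones ≢ c (mod 3)] has 𝔽₃-degree 2: `ones`, `zmod3_mul_self`, `hasDegF_three_ones_ne` via `Smolensky.mono`/`lowDeg` closure; `sum_card_ones_mod` pigeonhole), `not_exists_fullSumIndep3At_three`; so the prime hypothesis p ≠ 3 of FSI3W/SSI3W/LDI3W is load-bearing, matching the tree `¬ WalkHardF 3`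

See part A (`CharDialPartyDialA`) for the node header; memo `NODE-g35.md` (g35 folder of decomp-qadv-lens-5).
-/

set_option autoImplicit false
set_option linter.dupNamespace false

namespace Summit.QuantumAdvantage.QuantumAdvantage.Theorems.PartyDial

open Finset
open Summit.QuantumAdvantage.AdviceFreeQNC0

/-! ### §8j  TIGHTNESS IN `p`: the all-variables fact is FALSE at `p = 3` (so `5 ≤ p` — i.e. `p ≠ 2, 3` — is
load-bearing, matching the tree's `¬ WalkHardF 3`): `MOD₃` itself has `𝔽₃`-degree 2. -/

section AtThree

open Literature.Computability.MetaComplexity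

variable {m : ℕ}

/-- the number of ones of a point of the cube. -/
def ones (t : Fin m → Bool) : ℕ := (univ.filter fun i : Fin m => t i = true).card

/-- over `𝔽₃`, `z² = [z ≠ 0]`. -/
theorem zmod3_mul_self (z : ZMod 3) : z * z = if z = 0 then 0 else 1 := by
  revert z; decide

/-- the indicator of `#ones ≢ c (mod 3)` is the square `(Σ xᵢ − c)²` over `𝔽₃`, hence of `𝔽₃`-degree `≤ 2`. -/
theorem hasDegF_three_ones_ne (c : ℕ) :
    HasDegF 3 (fun t : Fin m → Bool => decide (ones t % 3 ≠ c % 3)) 2 := by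
  unfold HasDegF
  -- the linear form `s = Σ xᵢ` and the constant `c`
  set s : Smolensky.CubeFn (ZMod 3) m := ∑ i : Fin m, Smolensky.mono (ZMod 3) ({i} : Finset (Fin m)) with hs_def
  set k : Smolensky.CubeFn (ZMod 3) m := fun _ => (c : ZMod 3) with hk_def
  have hs : s ∈ Smolensky.lowDeg (ZMod 3) m 1 :=
    Submodule.sum_mem _ fun i _ => Smolensky.mono_mem_lowDeg (by simp)
  have hk : k ∈ Smolensky.lowDeg (ZMod 3) m 1 := by
    have h0 : Smolensky.mono (ZMod 3) (∅ : Finset (Fin m)) ∈ Smolensky.lowDeg (ZMod 3) m 1 :=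
      Smolensky.mono_mem_lowDeg (by simp)
    have : k = (c : ZMod 3) • Smolensky.mono (ZMod 3) (∅ : Finset (Fin m)) := by
      funext x
      simp [hk_def]
    rw [this]
    exact Submodule.smul_mem _ _ h0
  have hg : (s - k) * (s - k) ∈ Smolensky.lowDeg (ZMod 3) m (1 + 1) :=
    Smolensky.mul_mem_lowDeg_add (Submodule.sub_mem _ hs hk) (Submodule.sub_mem _ hs hk)
  have hsx : ∀ x : Fin m → Bool, s x = ((ones x : ℕ) : ZMod 3) := by
    intro x
    rw [hs_def, Finset.sum_apply]
    have : ∀ i : Fin m, Smolensky.mono (ZMod 3) ({i} : Finset (Fin m)) x = if x i = true then 1 else 0 := by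
      intro i
      rw [Smolensky.mono_apply]
      simp
    simp_rw [this]
    rw [Finset.sum_boole, ones]
  have heq : (fun x : Fin m → Bool => if decide (ones x % 3 ≠ c % 3) = true then (1 : ZMod 3) else 0) =
      (s - k) * (s - k) := by
    funext x
    rw [Pi.mul_apply, Pi.sub_apply, zmod3_mul_self, hsx, hk_def]
    simp only [sub_eq_zero, decide_eq_true_eq, ne_eq]
    have hiff : ((ones x : ℕ) : ZMod 3) = (c : ZMod 3) ↔ ones x % 3 = c % 3 := ZMod.natCast_eq_natCast_iff' _ _ _
    by_cases h : ones x % 3 = c % 3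
    · rw [if_neg (not_not.2 h), if_pos (hiff.2 h)]
    · rw [if_pos h, if_neg fun h' => h (hiff.1 h')]
  rw [heq]
  exact hg

/-- the three residue classes of `#ones` partition the cube. -/
theorem sum_card_ones_mod (m : ℕ) :
    ∑ c ∈ range 3, (univ.filter fun t : Fin m → Bool => ones t % 3 = c).card = 2 ^ m := by
  rw [← Finset.card_eq_sum_card_fiberwise (s := (univ : Finset (Fin m → Bool))) (t := range 3)
    (f := fun t => ones t % 3) (fun t _ => mem_range.2 (Nat.mod_lt _ (by norm_num)))]
  simp

/-- ★ **tightness in `p`**: `FullSumIndep3At 3 2 (1/5) m₀` fails for every `m₀` — at `p = 3` the Boolean `[#ones ≢ c (3)]`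
has `𝔽₃`-degree 2 and is perfectly correlated with `#ones mod 3`.  So the hypothesis `5 ≤ p` of `FSI3W`/`SSI3W`/`LDI3W`
(there: `p` prime, hence `p ≠ 3` is the content) cannot be dropped, in line with the tree's `¬ WalkHardF 3`. -/
theorem not_fullSumIndep3At_three (m₀ : ℕ) : ¬ FullSumIndep3At 3 2 (1 / 5) m₀ := by
  intro h
  -- a residue class `c` holding at most a third of the cube
  have hex : ∃ c, c < 3 ∧ 3 * (univ.filter fun t : Fin m₀ → Bool => ones t % 3 = c).card ≤ 2 ^ m₀ := by
    by_contra hne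
    have hlt : ∀ c ∈ range 3, 2 ^ m₀ < 3 * (univ.filter fun t : Fin m₀ → Bool => ones t % 3 = c).card :=
      fun c hc => lt_of_not_ge fun hle => hne ⟨c, mem_range.1 hc, hle⟩
    have := Finset.sum_lt_sum_of_nonempty (by simp) hlt
    rw [Finset.sum_const, card_range, smul_eq_mul, ← Finset.mul_sum, sum_card_ones_mod] at this
    exact lt_irrefl _ this
  obtain ⟨c, hc3, hc⟩ := hex
  have hcm : c % 3 = c := Nat.mod_eq_of_lt hc3
  have key := h m₀ le_rfl (fun t => decide (ones t % 3 ≠ c % 3)) (hasDegF_three_ones_ne c) 0 c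
  -- the right-hand side is empty
  have hR : (univ.filter fun t : Fin m₀ → Bool => decide (ones t % 3 ≠ c % 3) = true ∧
      (0 + (univ.filter fun i : Fin m₀ => t i = true).card) % 3 = c % 3) = ∅ := by
    refine Finset.filter_false_of_mem fun t _ => ?_
    rw [decide_eq_true_eq, zero_add]
    exact fun hh => hh.1 hh.2
  -- the left-hand side counts the complement of the class `c`
  have hL : (univ.filter fun t : Fin m₀ → Bool => decide (ones t % 3 ≠ c % 3) = true).card +
      (univ.filter fun t : Fin m₀ → Bool => ones t % 3 = c).card = 2 ^ m₀ := by
    have := Finset.card_filter_add_card_filter_not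
      (s := (univ : Finset (Fin m₀ → Bool))) (fun t : Fin m₀ → Bool => ones t % 3 = c)
    rw [Finset.card_univ, Fintype.card_fun, Fintype.card_bool, Fintype.card_fin] at this
    have hc' : (univ.filter fun t : Fin m₀ → Bool => decide (ones t % 3 ≠ c % 3) = true) =
        univ.filter fun t : Fin m₀ → Bool => ¬ (ones t % 3 = c) :=
      Finset.filter_congr fun t _ => by rw [decide_eq_true_eq, hcm]
    rw [hc', add_comm]
    exact this
  rw [hR, Finset.card_empty, Nat.cast_zero] at key
  have hLr : ((univ.filter fun t : Fin m₀ → Bool => decide (ones t % 3 ≠ c % 3) = true).card : ℝ) =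
      (2 : ℝ) ^ m₀ - ((univ.filter fun t : Fin m₀ → Bool => ones t % 3 = c).card : ℝ) := by
    rw [eq_sub_iff_add_eq]
    exact_mod_cast hL
  have hcr : 3 * ((univ.filter fun t : Fin m₀ → Bool => ones t % 3 = c).card : ℝ) ≤ (2 : ℝ) ^ m₀ := by
    exact_mod_cast hc
  rw [hLr] at key
  have h2 : (0 : ℝ) < (2 : ℝ) ^ m₀ := by positivity
  linarith

/-- hence no `m₀` rescues the level form at `p = 3` (were `3` admitted): recorded as the `p`-tightness of §8i. -/
theorem not_exists_fullSumIndep3At_three : ¬ ∃ m₀ : ℕ, FullSumIndep3At 3 2 (1 / 5) m₀ :=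
  fun ⟨m₀, h⟩ => not_fullSumIndep3At_three m₀ h

end AtThree

end Summit.QuantumAdvantage.QuantumAdvantage.Theorems.PartyDial
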